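import Summits.HodgeConjecture.HodgeConjecture.Cruxes.BlochSeedDiscOne.HeightTower

/-!
line stmt-HodgeConjecture-18881 Cruxes/BlochSeedDiscOne/Lines/birth.lean 814a6a70c14e831a stub_rung_pad4_seedAt

# RotatedPairA4Design — an EXPLICIT (A1)-clean (A4) integer design with `μ ≠ 0` on the height-6 alphabet, copies `5008`, rank `8`:
`Nonex h B 8` is FALSE for every `h ≥ 6`, `B ≥ 5008`, and `FloorFree 6 B 8` is FALSE for every `B ≥ 5008` — KERNEL CERTIFICATE
(plan-lens-HodgeAV-strengthen g14, lens «strengthen»; STRENGTHEN-MEMO-21 §5 / S⁺-ledger v1.27 row #150)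

STATUS: evidence + typed files, not rungs. Letters ≠ sheaves. NOTHING here is proved toward HC ∕ HC_CM ∕ HC_AV ∕ №4 ∕ 26512 ∕ 18881 ∕ H2,
nothing here is a monad, a source, a SEED or a design of record, and nothing here decides `Nonex 14 199 8`, `Nonex 6 199 8`, `FloorFree 6 199 8`,
`DepthBound 14 199 8 3` or `stub_depthBound_three`: the budget of record is `B = 199`, this design has `5008` copies. What IS kernel-checked:

* `D` (§3) is an explicit two-term design on the height-6 widened alphabet (13 N-letters, 12 P-letters, 321 + 324 cells) — the «ROTATED PAIR»
  `N = Σ_{k<4} (ρᵏu)^{⊠4} + 8·hub⁴`, `P = Σ_{k<4} (ρᵏu′)^{⊠4}` with `u = 3·(2;2,2) + (3;1,2) + (6;0,0)`, `u′ = (0;3,3) + (3;2,1) + 3·(4;1,1)`,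
  `ρ` = rotation `β ↦ iβ`; `u, u′` have equal moment vectors `(U₁,U_h,U_pt) = (5,15,28)` and `|Σβ| = |Σβ′|` (`7+8i` vs `8+7i`), which is WHY it is
  (A1)-clean (the `C₄`-orbit kills the words with `#e ≢ #ē (mod 4)`, the N∕P balance kills the rest) — but the file does not rely on the why:
* `design_cert : D.OnAlphabet 6 ∧ D.A1 ∧ D.A4 ∧ D.mu ≠ 0 ∧ D.copies = 5008 ∧ D.rank = 8` — ALL SIX by `decide +kernel`: (A1) on the CLOSED FORM
  `T(D)(w) = 8·ch(hub⁴)(w) + Σ_k Π_f ⟨ρᵏu, w_f⟩ − Σ_k Π_f ⟨ρᵏu′, w_f⟩` (§2: the product block `u^{⊠4}` is a `List.flatMap`, its class tensor FACTORISES slot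
  by slot — `listSum_prod4`, proved by induction — and a raw `ℤ × ℤ` evaluator is proved equal to `Design.T`, the idiom of `DesignKernel.lean`), a
  625-word table (`a1_table`); (A4), the alphabet, positivity, copies and rank by brute force on the expanded cell lists (the kernel expands `prod4`);
  `μ(D) = T(D)(eeee) = 26880·i` (`mu_eq`), e-free charges `q_d = 8·6^d`;
* `not_nonex_six : ¬ Nonex 6 5008 8`, `not_nonex : ∀ h ≥ 6, ∀ B ≥ 5008, ¬ Nonex h B 8` (via `HeightTower.nonex_of_nonex_up`: the design shifts up),
  `not_floorFree_six : ∀ B ≥ 5008, ¬ FloorFree 6 B 8` (the P-cell `(0;3,3)⁴` is a floor cell).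
CONSEQUENCE FOR THE NODE (MEMO-21 §5): the conjecture of record `Nonex 14 199 8` (⇔ the nine floors) is BUDGET-SENSITIVE — its budget-free form is
false at every height `≥ 6`; any proof must use `copies ≤ 199` (or a rank∕μ-normalisation) essentially; the gap is `199 < B* ≤ 5008` (`B*` = least
budget admitting an (A1)∧(A4) design with `μ ≠ 0`, rank `≥ 8`, some height). No rotated-pair design has `U₁ ≤ 4` (exhaustive, eng/rotclash.py:
`U₁ ≤ 3` none even with cell cancellation; `U₁ = 4` none with disjoint letter classes), so `5008 = 8·5⁴ + 8` is the minimum OF THIS FAMILY only.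
PROVENANCE (irrelevant to validity): eng/rotpair2.py, explicit_cert.py → memo-21/minmu/NONEX-h6-B5008.json (stdlib verifier verify_explicit.py: ALL
CHECKS PASS), gen_lean_cert2.py → this file. `decide +kernel` only: no `native_decide`, no `sorry`, no `axiom`, no `instance`, no notation, no
Literature fact, no unsafe reducibility option.
-/

set_option linter.dupNamespace false
set_option autoImplicit false
set_option maxRecDepth 8192
set_option maxHeartbeats 4000000

namespace Summit.HodgeConjecture.HodgeConjecture.Cruxes.BlochSeedDiscOne.RotatedPairA4Design

open Summit.HodgeConjecture.HodgeConjecture.Cruxes.BlochSeedDiscOne.DepthBoundA4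
open Summit.HodgeConjecture.HodgeConjecture.Cruxes.BlochSeedDiscOne.IntegralityGap
open Summit.HodgeConjecture.HodgeConjecture.Cruxes.BlochSeedDiscOne.HeightTower

/-! ## §1 Raw `ℤ[i]` arithmetic and the raw class-tensor evaluator (the `DesignKernel.lean` idiom, for `DepthBoundA4.Design`) -/

/-- product of Gaussian integers written as integer pairs `(re, im)`. -/
def gmul (a b : ℤ × ℤ) : ℤ × ℤ := (a.1 * b.1 - a.2 * b.2, a.1 * b.2 + a.2 * b.1)

/-- the pair as a Gaussian integer. -/
def toG (p : ℤ × ℤ) : GaussianInt := ⟨p.1, p.2⟩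

theorem toG_gmul (a b : ℤ × ℤ) : toG (gmul a b) = toG a * toG b := by
  ext
  · simp [toG, gmul, Zsqrtd.re_mul]; ring
  · simp [toG, gmul, Zsqrtd.im_mul]

/-- force an integer to constructor form before continuing (keeps kernel evaluation of long folds strict). -/
def forceInt {α : Type} (z : ℤ) (k : ℤ → α) : α :=
  match z with
  | Int.ofNat n => k (Int.ofNat n)
  | Int.negSucc n => k (Int.negSucc n)

theorem forceInt_eq {α : Type} (z : ℤ) (k : ℤ → α) : forceInt z k = k z := by
  cases z <;> rfl

/-- raw coefficient of a symbol at a letter: `1 ↦ 1`, `h ↦ a`, `e ↦ β̄`, `ē ↦ β`, `pt ↦ a² − |β|²`. -/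
def symv (ℓ : Letter) : Sym → ℤ × ℤ
  | .one => (1, 0)
  | .h => (ℓ.a, 0)
  | .e => (ℓ.x, -ℓ.y)
  | .ebar => (ℓ.x, ℓ.y)
  | .pt => (ℓ.a * ℓ.a - ℓ.x * ℓ.x - ℓ.y * ℓ.y, 0)

theorem toG_symv (ℓ : Letter) (s : Sym) : toG (symv ℓ s) = s.coef ℓ := by
  cases s <;> (ext <;> (simp [toG, symv, Sym.coef, Letter.beta, Letter.selfInt, Letter.bnorm, pow_two]; try ring))

/-- raw class tensor of one cell at a word. -/
def chRaw (c : Cell) (w : Word) : ℤ × ℤ :=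
  gmul (gmul (gmul (symv (c 0) (w 0)) (symv (c 1) (w 1))) (symv (c 2) (w 2))) (symv (c 3) (w 3))

theorem toG_chRaw (c : Cell) (w : Word) : toG (chRaw c w) = cellCoef c w := by
  simp only [chRaw, toG_gmul, toG_symv, cellCoef, Fin.prod_univ_four]

/-- the list sum `Σ m · cellCoef` (the summand of `Design.T`). -/
def listSum (w : Word) (L : List (Cell × ℕ)) : GaussianInt := (L.map fun cm => (cm.2 : GaussianInt) * cellCoef cm.1 w).sum

theorem listSum_nil (w : Word) : listSum w [] = 0 := by simp [listSum]

theorem listSum_cons (w : Word) (cm : Cell × ℕ) (L : List (Cell × ℕ)) :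
    listSum w (cm :: L) = (cm.2 : GaussianInt) * cellCoef cm.1 w + listSum w L := by simp [listSum]

theorem listSum_append (w : Word) (L M : List (Cell × ℕ)) : listSum w (L ++ M) = listSum w L + listSum w M := by
  simp [listSum, List.map_append, List.sum_append]

theorem T_eq_listSum (E : Design) (w : Word) : E.T w = listSum w E.N - listSum w E.P := rfl

/-- componentwise pair operations (raw `ℤ[i]` addition, subtraction, integer scaling). -/
def padd (a b : ℤ × ℤ) : ℤ × ℤ := (a.1 + b.1, a.2 + b.2)
/-- subtraction. -/
def psub (a b : ℤ × ℤ) : ℤ × ℤ := (a.1 - b.1, a.2 - b.2)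
/-- scaling. -/
def pscale (k : ℤ) (a : ℤ × ℤ) : ℤ × ℤ := (k * a.1, k * a.2)

theorem toG_padd (a b : ℤ × ℤ) : toG (padd a b) = toG a + toG b := by ext <;> simp [toG, padd]
theorem toG_psub (a b : ℤ × ℤ) : toG (psub a b) = toG a - toG b := by ext <;> simp [toG, psub]
theorem toG_pscale (k : ℤ) (a : ℤ × ℤ) : toG (pscale k a) = (k : GaussianInt) * toG a := by
  ext <;> simp [toG, pscale]

/-! ## §2 Boolean list checkers, words, cells -/

/-- every element passes (tail form). -/
def allB {α : Type} : List α → (α → Bool) → Bool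
  | [], _ => true
  | x :: l, f => match f x with | true => allB l f | false => false

theorem allB_iff {α : Type} (l : List α) (f : α → Bool) : allB l f = true ↔ ∀ x ∈ l, f x = true := by
  induction l with
  | nil => simp [allB]
  | cons x l ih =>
    simp only [allB, List.mem_cons, forall_eq_or_imp]
    cases hx : f x <;> simp [ih]

/-- some element passes (tail form). -/
def anyB {α : Type} : List α → (α → Bool) → Bool
  | [], _ => false
  | x :: l, f => match f x with | true => true | false => anyB l f

theorem anyB_iff {α : Type} (l : List α) (f : α → Bool) : anyB l f = true ↔ ∃ x ∈ l, f x = true := by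
  induction l with
  | nil => simp [anyB]
  | cons x l ih =>
    simp only [anyB, List.mem_cons, exists_eq_or_imp]
    cases hx : f x <;> simp [ih]

/-- a word from four symbols. -/
def wordOf (s₀ s₁ s₂ s₃ : Sym) : Word := fun f =>
  match f with
  | ⟨0, _⟩ => s₀
  | ⟨1, _⟩ => s₁
  | ⟨2, _⟩ => s₂
  | ⟨_, _⟩ => s₃

theorem wordOf_eta (w : Word) : wordOf (w 0) (w 1) (w 2) (w 3) = w := by
  funext f
  fin_cases f <;> rfl

/-- a cell from four letters. -/
def cellOf (l₀ l₁ l₂ l₃ : Letter) : Cell := fun f =>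
  match f with
  | ⟨0, _⟩ => l₀
  | ⟨1, _⟩ => l₁
  | ⟨2, _⟩ => l₂
  | ⟨_, _⟩ => l₃

theorem cellCoef_cellOf (a b c d : Letter) (w : Word) :
    cellCoef (cellOf a b c d) w = (w 0).coef a * (w 1).coef b * (w 2).coef c * (w 3).coef d := by
  simp only [cellCoef, Fin.prod_univ_four]
  rfl

/-! ### Product blocks `u^{⊠4}` and the slot-by-slot factorisation of their class tensor -/

/-- weighted letter sum `Σ m·φ(ℓ)` over a letter list `u`. -/
def lsum (u : List (Letter × ℕ)) (φ : Letter → GaussianInt) : GaussianInt := (u.map fun e => (e.2 : GaussianInt) * φ e.1).sum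

theorem lsum_nil (φ : Letter → GaussianInt) : lsum [] φ = 0 := by simp [lsum]

theorem lsum_cons (e : Letter × ℕ) (u : List (Letter × ℕ)) (φ : Letter → GaussianInt) :
    lsum (e :: u) φ = (e.2 : GaussianInt) * φ e.1 + lsum u φ := by simp [lsum]

/-- level 3: the last slot runs over `u`. -/
def blk3 (u : List (Letter × ℕ)) (a b c : Letter) (m : ℕ) : List (Cell × ℕ) := u.map fun e => (cellOf a b c e.1, m * e.2)
/-- level 2. -/
def blk2 (u : List (Letter × ℕ)) (a b : Letter) (m : ℕ) : List (Cell × ℕ) := u.flatMap fun e => blk3 u a b e.1 (m * e.2)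
/-- level 1. -/
def blk1 (u : List (Letter × ℕ)) (a : Letter) (m : ℕ) : List (Cell × ℕ) := u.flatMap fun e => blk2 u a e.1 (m * e.2)
/-- the product block `u^{⊠4}`: every cell with letters from `u`, multiplicity the product of the four weights. -/
def prod4 (u : List (Letter × ℕ)) : List (Cell × ℕ) := u.flatMap fun e => blk1 u e.1 e.2

theorem listSum_blk3 (w : Word) (u : List (Letter × ℕ)) (a b c : Letter) (m : ℕ) :
    listSum w (blk3 u a b c m) = (m : GaussianInt) * ((w 0).coef a * (w 1).coef b * (w 2).coef c) * lsum u (w 3).coef := by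
  induction u with
  | nil => simp [blk3, listSum, lsum]
  | cons e u ih =>
    have h3 : blk3 (e :: u) a b c m = (cellOf a b c e.1, m * e.2) :: blk3 u a b c m := rfl
    rw [h3, listSum_cons, ih, lsum_cons, cellCoef_cellOf]
    push_cast
    ring

theorem listSum_blk2 (w : Word) (v u : List (Letter × ℕ)) (a b : Letter) (m : ℕ) :
    listSum w (v.flatMap fun e => blk3 u a b e.1 (m * e.2)) =
      (m : GaussianInt) * ((w 0).coef a * (w 1).coef b) * lsum v (w 2).coef * lsum u (w 3).coef := by
  induction v with
  | nil => simp [listSum, lsum]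
  | cons e v ih =>
    rw [List.flatMap_cons, listSum_append, ih, listSum_blk3, lsum_cons]
    push_cast
    ring

theorem listSum_blk1 (w : Word) (v u : List (Letter × ℕ)) (a : Letter) (m : ℕ) :
    listSum w (v.flatMap fun e => blk2 u a e.1 (m * e.2)) =
      (m : GaussianInt) * (w 0).coef a * lsum v (w 1).coef * lsum u (w 2).coef * lsum u (w 3).coef := by
  induction v with
  | nil => simp [listSum, lsum]
  | cons e v ih =>
    rw [List.flatMap_cons, listSum_append, ih, lsum_cons]
    have h2 : blk2 u a e.1 (m * e.2) = u.flatMap fun e' => blk3 u a e.1 e'.1 ((m * e.2) * e'.2) := rfl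
    rw [h2, listSum_blk2]
    push_cast
    ring

theorem listSum_prod4_aux (w : Word) (v u : List (Letter × ℕ)) :
    listSum w (v.flatMap fun e => blk1 u e.1 e.2) = lsum v (w 0).coef * lsum u (w 1).coef * lsum u (w 2).coef * lsum u (w 3).coef := by
  induction v with
  | nil => simp [listSum, lsum]
  | cons e v ih =>
    rw [List.flatMap_cons, listSum_append, ih, lsum_cons]
    have h1 : blk1 u e.1 e.2 = u.flatMap fun e' => blk2 u e.1 e'.1 (e.2 * e'.2) := rfl
    rw [h1, listSum_blk1]
    ring

/-- THE FACTORISATION: `T(u^{⊠4})(w) = Π_f ⟨u, w_f⟩`. -/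
theorem listSum_prod4 (w : Word) (u : List (Letter × ℕ)) :
    listSum w (prod4 u) = lsum u (w 0).coef * lsum u (w 1).coef * lsum u (w 2).coef * lsum u (w 3).coef :=
  listSum_prod4_aux w u u

/-- raw letter sum `Σ m·symv(ℓ)(s)`, accumulator form. -/
def lsumRaw (s : Sym) : List (Letter × ℕ) → ℤ → ℤ → ℤ × ℤ
  | [], p, q => (p, q)
  | (ℓ, m) :: u, p, q =>
    match symv ℓ s with
    | (a, b) => forceInt (p + (m : ℤ) * a) fun p' => forceInt (q + (m : ℤ) * b) fun q' => lsumRaw s u p' q'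

theorem toG_lsumRaw (s : Sym) (u : List (Letter × ℕ)) (p q : ℤ) : toG (lsumRaw s u p q) = toG (p, q) + lsum u s.coef := by
  induction u generalizing p q with
  | nil => simp [lsumRaw, lsum, toG]
  | cons e u ih =>
    obtain ⟨ℓ, m⟩ := e
    have hc : toG (symv ℓ s) = s.coef ℓ := toG_symv ℓ s
    simp only [lsumRaw, forceInt_eq]
    rw [ih, lsum_cons, ← hc]
    ext
    · simp [toG]; ring
    · simp [toG]; ring

/-- raw class tensor of a product block: the product of the four raw letter sums. -/
def blockRaw (u : List (Letter × ℕ)) (w : Word) : ℤ × ℤ :=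
  gmul (gmul (gmul (lsumRaw (w 0) u 0 0) (lsumRaw (w 1) u 0 0)) (lsumRaw (w 2) u 0 0)) (lsumRaw (w 3) u 0 0)

theorem toG_zero : toG ((0 : ℤ), (0 : ℤ)) = 0 := by ext <;> simp [toG]

theorem toG_blockRaw (u : List (Letter × ℕ)) (w : Word) : toG (blockRaw u w) = listSum w (prod4 u) := by
  rw [listSum_prod4]
  simp only [blockRaw, toG_gmul, toG_lsumRaw, toG_zero, zero_add]

/-- the five symbols. -/
def syms : List Sym := [Sym.one, Sym.h, Sym.e, Sym.ebar, Sym.pt]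

theorem mem_syms (s : Sym) : s ∈ syms := by
  cases s <;> simp [syms]

/-- all 625 words. -/
def allWords : List Word :=
  syms.flatMap fun a => syms.flatMap fun b => syms.flatMap fun c => syms.map fun d => wordOf a b c d

theorem mem_allWords (w : Word) : w ∈ allWords := by
  rw [← wordOf_eta w]
  simp only [allWords, List.mem_flatMap, List.mem_map]
  exact ⟨w 0, mem_syms _, w 1, mem_syms _, w 2, mem_syms _, w 3, mem_syms _, rfl⟩

/-- e-free test (raw form of `Word.efree`). -/
def efreeB (w : Word) : Bool := (w 0).efree && (w 1).efree && (w 2).efree && (w 3).efree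

theorem efree_of_efreeB {w : Word} (h : efreeB w = true) : w.efree := by
  simp only [efreeB, Bool.and_eq_true] at h
  obtain ⟨⟨⟨h0, h1⟩, h2⟩, h3⟩ := h
  intro f
  fin_cases f
  · exact h0
  · exact h1
  · exact h2
  · exact h3

theorem efreeB_of_efree {w : Word} (h : w.efree) : efreeB w = true := by
  simp [efreeB, h 0, h 1, h 2, h 3]

/-- Bloch-word test (raw form of `w = eeee ∨ w = ēēēē`). -/
def blochB (w : Word) : Bool :=
  (decide (w 0 = Sym.e) && decide (w 1 = Sym.e) && decide (w 2 = Sym.e) && decide (w 3 = Sym.e)) ||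
  (decide (w 0 = Sym.ebar) && decide (w 1 = Sym.ebar) && decide (w 2 = Sym.ebar) && decide (w 3 = Sym.ebar))

theorem bloch_of_blochB {w : Word} (h : blochB w = true) : w = Word.eeee ∨ w = Word.EEEE := by
  simp only [blochB, Bool.or_eq_true, Bool.and_eq_true, decide_eq_true_eq] at h
  rcases h with ⟨⟨⟨h0, h1⟩, h2⟩, h3⟩ | ⟨⟨⟨h0, h1⟩, h2⟩, h3⟩
  · left; funext f; fin_cases f
    · exact h0
    · exact h1
    · exact h2
    · exact h3
  · right; funext f; fin_cases f
    · exact h0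
    · exact h1
    · exact h2
    · exact h3

/-- raw degree. -/
def degB (w : Word) : ℕ := (w 0).deg + (w 1).deg + (w 2).deg + (w 3).deg

theorem deg_eq_degB (w : Word) : w.deg = degB w := by
  simp only [Word.deg, Fin.sum_univ_four, degB]

/-- raw alphabet test for a letter and a cell (raw form of `Letter.OnAlphabet`). -/
def lettB (h : ℤ) (ℓ : Letter) : Bool := decide (ℓ.a + |ℓ.x| + |ℓ.y| = h ∧ 0 ≤ ℓ.a)

/-- cell on the alphabet. -/
def onAlphaB (h : ℤ) (c : Cell) : Bool := lettB h (c 0) && lettB h (c 1) && lettB h (c 2) && lettB h (c 3)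

theorem onAlphabet_of_B {h : ℤ} {c : Cell} (hc : onAlphaB h c = true) : ∀ f : Fin 4, (c f).OnAlphabet h := by
  simp only [onAlphaB, lettB, Bool.and_eq_true, decide_eq_true_eq] at hc
  obtain ⟨⟨⟨h0, h1⟩, h2⟩, h3⟩ := hc
  intro f
  fin_cases f
  · exact h0
  · exact h1
  · exact h2
  · exact h3

/-- raw ample-above test (squares written as products). -/
def ampleB (ℓ ℓ' : Letter) : Bool :=
  decide (ℓ.a < ℓ'.a) && decide ((ℓ'.x - ℓ.x) * (ℓ'.x - ℓ.x) + (ℓ'.y - ℓ.y) * (ℓ'.y - ℓ.y) < (ℓ'.a - ℓ.a) * (ℓ'.a - ℓ.a))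

theorem ampleAbove_of_B {ℓ ℓ' : Letter} (h : ampleB ℓ ℓ' = true) : AmpleAbove ℓ ℓ' := by
  simp only [ampleB, Bool.and_eq_true, decide_eq_true_eq] at h
  refine ⟨h.1, ?_⟩
  simp only [pow_two]
  exact h.2

/-- raw live test. -/
def liveB (x y : Cell) : Bool := ampleB (x 0) (y 0) && ampleB (x 1) (y 1) && ampleB (x 2) (y 2) && ampleB (x 3) (y 3)

theorem live_of_B {x y : Cell} (h : liveB x y = true) : Live x y := by
  simp only [liveB, Bool.and_eq_true] at h
  obtain ⟨⟨⟨h0, h1⟩, h2⟩, h3⟩ := h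
  intro f
  fin_cases f
  · exact ampleAbove_of_B h0
  · exact ampleAbove_of_B h1
  · exact ampleAbove_of_B h2
  · exact ampleAbove_of_B h3

/-- support membership from an entry with positive multiplicity. -/
theorem mem_suppN_of {D : Design} {c : Cell} {m : ℕ} (h : (c, m) ∈ D.N) (hm : 0 < m) : c ∈ D.suppN :=
  List.mem_map.2 ⟨(c, m), List.mem_filter.2 ⟨h, by simpa using hm⟩, rfl⟩

theorem mem_suppP_of {D : Design} {c : Cell} {m : ℕ} (h : (c, m) ∈ D.P) (hm : 0 < m) : c ∈ D.suppP :=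
  List.mem_map.2 ⟨(c, m), List.mem_filter.2 ⟨h, by simpa using hm⟩, rfl⟩

theorem exists_of_mem_suppN {D : Design} {c : Cell} (h : c ∈ D.suppN) : ∃ m, (c, m) ∈ D.N := by
  obtain ⟨cm, hcm, rfl⟩ := List.mem_map.1 h
  exact ⟨cm.2, (List.mem_filter.1 hcm).1⟩

theorem exists_of_mem_suppP {D : Design} {c : Cell} (h : c ∈ D.suppP) : ∃ m, (c, m) ∈ D.P := by
  obtain ⟨cm, hcm, rfl⟩ := List.mem_map.1 h
  exact ⟨cm.2, (List.mem_filter.1 hcm).1⟩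

/-! ## §3 The design `D = (8·hub⁴ + Σ_k (ρᵏu)^{⊠4}, Σ_k (ρᵏu′)^{⊠4})` -/

/-- the hub cell `(6;0,0)⁴`. -/
def hub4 : Cell := cellOf ⟨6, 0, 0⟩ ⟨6, 0, 0⟩ ⟨6, 0, 0⟩ ⟨6, 0, 0⟩

/-- the floor cell `(0;3,3)⁴`. -/
def floor4 : Cell := cellOf ⟨0, 3, 3⟩ ⟨0, 3, 3⟩ ⟨0, 3, 3⟩ ⟨0, 3, 3⟩

/-- `u = (6;0,0) + 3·(2;2,2) + (3;1,2)` and its rotations `ρᵏu`, `ρ(a;x,y) = (a;−y,x)`. -/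
def uN0 : List (Letter × ℕ) := [(⟨6, 0, 0⟩, 1), (⟨2, 2, 2⟩, 3), (⟨3, 1, 2⟩, 1)]
def uN1 : List (Letter × ℕ) := [(⟨6, 0, 0⟩, 1), (⟨2, -2, 2⟩, 3), (⟨3, -2, 1⟩, 1)]
def uN2 : List (Letter × ℕ) := [(⟨6, 0, 0⟩, 1), (⟨2, -2, -2⟩, 3), (⟨3, -1, -2⟩, 1)]
def uN3 : List (Letter × ℕ) := [(⟨6, 0, 0⟩, 1), (⟨2, 2, -2⟩, 3), (⟨3, 2, -1⟩, 1)]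
/-- `u′ = (0;3,3) + (3;2,1) + 3·(4;1,1)` and its rotations. -/
def vP0 : List (Letter × ℕ) := [(⟨0, 3, 3⟩, 1), (⟨3, 2, 1⟩, 1), (⟨4, 1, 1⟩, 3)]
def vP1 : List (Letter × ℕ) := [(⟨0, -3, 3⟩, 1), (⟨3, -1, 2⟩, 1), (⟨4, -1, 1⟩, 3)]
def vP2 : List (Letter × ℕ) := [(⟨0, -3, -3⟩, 1), (⟨3, -2, -1⟩, 1), (⟨4, -1, -1⟩, 3)]
def vP3 : List (Letter × ℕ) := [(⟨0, 3, -3⟩, 1), (⟨3, 1, -2⟩, 1), (⟨4, 1, -1⟩, 3)]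

/-- N-list: `8·hub⁴` first, then the four rotated product blocks (`hub⁴` also occurs inside each block, with multiplicity 1). -/
def DN : List (Cell × ℕ) := (hub4, 8) :: (prod4 uN0 ++ prod4 uN1 ++ prod4 uN2 ++ prod4 uN3)

/-- P-list: the four rotated product blocks of `u′` (the first cell of the first block is the floor cell `(0;3,3)⁴`). -/
def DP : List (Cell × ℕ) := prod4 vP0 ++ prod4 vP1 ++ prod4 vP2 ++ prod4 vP3

/-- the rotated-pair design. -/
def D : Design := ⟨DN, DP⟩

theorem hub4_mem : (hub4, 8) ∈ D.N := List.mem_cons_self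

theorem floor4_mem : (floor4, 1) ∈ D.P :=
  List.mem_append_left _ (List.mem_append_left _ (List.mem_append_left _ List.mem_cons_self))

/-- raw closed form of `T(D)(w)`: `8·ch(hub⁴)(w) + Σ_k block(ρᵏu)(w) − Σ_k block(ρᵏu′)(w)`. -/
def rawClosed (w : Word) : ℤ × ℤ :=
  psub (padd (pscale 8 (chRaw hub4 w))
          (padd (padd (padd (blockRaw uN0 w) (blockRaw uN1 w)) (blockRaw uN2 w)) (blockRaw uN3 w)))
       (padd (padd (padd (blockRaw vP0 w) (blockRaw vP1 w)) (blockRaw vP2 w)) (blockRaw vP3 w))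

theorem T_split (w : Word) : D.T w = (8 : GaussianInt) * cellCoef hub4 w
    + (listSum w (prod4 uN0) + listSum w (prod4 uN1) + listSum w (prod4 uN2) + listSum w (prod4 uN3))
    - (listSum w (prod4 vP0) + listSum w (prod4 vP1) + listSum w (prod4 vP2) + listSum w (prod4 vP3)) := by
  rw [T_eq_listSum]
  have hN : D.N = (hub4, 8) :: (prod4 uN0 ++ prod4 uN1 ++ prod4 uN2 ++ prod4 uN3) := rfl
  have hP : D.P = prod4 vP0 ++ prod4 vP1 ++ prod4 vP2 ++ prod4 vP3 := rfl
  rw [hN, hP, listSum_cons, listSum_append, listSum_append, listSum_append, listSum_append, listSum_append, listSum_append]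
  push_cast
  ring

theorem T_closed (w : Word) : D.T w = toG (rawClosed w) := by
  rw [T_split]
  simp only [rawClosed, toG_psub, toG_padd, toG_pscale, toG_chRaw, toG_blockRaw]
  push_cast
  ring

/-! ## §4 The kernel computations (`decide +kernel`) -/

/-- one row of the (A1) table on the closed form: e-free words evaluate to `8·6^deg` (real), every other word except the two Bloch words vanishes. -/
def a1Row (w : Word) : Bool :=
  bif efreeB w then decide (rawClosed w = ((8 : ℤ) * 6 ^ degB w, 0)) else (blochB w || decide (rawClosed w = (0, 0)))

theorem a1_table : allB allWords a1Row = true := by decide +kernel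

theorem mu_raw : rawClosed Word.eeee = (0, 26880) := by decide +kernel

theorem copies_eq : D.copies = 5008 := by decide +kernel

theorem rank_eq : D.rank = 8 := by decide +kernel

theorem posN : allB DN (fun cm => decide (0 < cm.2)) = true := by decide +kernel

theorem posP : allB DP (fun cm => decide (0 < cm.2)) = true := by decide +kernel

theorem alphaN : allB DN (fun cm => onAlphaB 6 cm.1) = true := by decide +kernel

theorem alphaP : allB DP (fun cm => onAlphaB 6 cm.1) = true := by decide +kernel

/-- (A4).1 witnesses: every P-cell is live below `hub⁴`. -/
theorem a4P : allB DP (fun cm => liveB cm.1 hub4) = true := by decide +kernel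

/-- (A4).2 witnesses: every N-cell has a live P-cell below it (brute force over the P-list). -/
theorem a4N : allB DN (fun cn => anyB DP (fun cm => liveB cm.1 cn.1)) = true := by decide +kernel

/-! ## §5 The certificate and its consequences -/

theorem onAlphabet_D : D.OnAlphabet 6 := by
  intro c hc f
  rcases List.mem_append.1 hc with hN | hP
  · obtain ⟨m, hm⟩ := exists_of_mem_suppN hN
    exact onAlphabet_of_B ((allB_iff _ _).1 alphaN (c, m) hm) f
  · obtain ⟨m, hm⟩ := exists_of_mem_suppP hP
    exact onAlphabet_of_B ((allB_iff _ _).1 alphaP (c, m) hm) f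

theorem a1_D : D.A1 := by
  constructor
  · intro w hne h1 h2
    have hr := (allB_iff _ _).1 a1_table w (mem_allWords w)
    unfold a1Row at hr
    cases hb : efreeB w with
    | true => exact (hne (efree_of_efreeB hb)).elim
    | false =>
      rw [hb] at hr
      simp only [cond_false, Bool.or_eq_true, decide_eq_true_eq] at hr
      rcases hr with hbl | hz
      · rcases bloch_of_blochB hbl with h | h
        · exact (h1 h).elim
        · exact (h2 h).elim
      · rw [T_closed, hz]; ext <;> simp [toG]
  · intro w w' hw hw' hd
    have hr := (allB_iff _ _).1 a1_table w (mem_allWords w)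
    have hr' := (allB_iff _ _).1 a1_table w' (mem_allWords w')
    unfold a1Row at hr hr'
    rw [efreeB_of_efree hw] at hr
    rw [efreeB_of_efree hw'] at hr'
    simp only [cond_true, decide_eq_true_eq] at hr hr'
    have hdd : degB w = degB w' := by rw [← deg_eq_degB, ← deg_eq_degB, hd]
    rw [T_closed, T_closed, hr, hr', hdd]

theorem mu_eq : D.mu = ⟨0, 26880⟩ := by
  show D.T Word.eeee = _
  rw [T_closed, mu_raw]
  rfl

theorem mu_ne : D.mu ≠ 0 := by
  rw [mu_eq]
  decide

theorem hub4_suppN : hub4 ∈ D.suppN := mem_suppN_of hub4_mem (by decide)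

theorem floor4_suppP : floor4 ∈ D.suppP := mem_suppP_of floor4_mem (by decide)

theorem a4_D : D.A4 := by
  constructor
  · intro x hx
    obtain ⟨m, hm⟩ := exists_of_mem_suppP hx
    exact ⟨hub4, hub4_suppN, live_of_B ((allB_iff _ _).1 a4P (x, m) hm)⟩
  · intro y hy
    obtain ⟨m, hm⟩ := exists_of_mem_suppN hy
    have h := (allB_iff _ _).1 a4N (y, m) hm
    obtain ⟨cm, hcm, hl⟩ := (anyB_iff _ _).1 h
    have hpos : 0 < cm.2 := of_decide_eq_true ((allB_iff _ _).1 posP cm hcm)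
    exact ⟨cm.1, mem_suppP_of hcm hpos, live_of_B hl⟩

/-- THE CERTIFICATE: `D` is an (A1)-clean (A4) design with `μ ≠ 0` on the height-6 alphabet, `5008` copies, rank `8`. -/
theorem design_cert : D.OnAlphabet 6 ∧ D.A1 ∧ D.A4 ∧ D.mu ≠ 0 ∧ D.copies = 5008 ∧ D.rank = 8 :=
  ⟨onAlphabet_D, a1_D, a4_D, mu_ne, copies_eq, rank_eq⟩

/-- `Nonex 6 5008 8` is false. -/
theorem not_nonex_six : ¬ Nonex 6 5008 8 := fun hn =>
  hn D onAlphabet_D a1_D a4_D mu_ne (le_of_eq copies_eq) (le_of_eq rank_eq.symm)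

/-- `Nonex h B 8` is false for every height `h ≥ 6` and every budget `B ≥ 5008` (shift the design up by `h − 6`). -/
theorem not_nonex (h : ℤ) (hh : 6 ≤ h) (B : ℕ) (hB : 5008 ≤ B) : ¬ Nonex h B 8 := by
  intro hn
  have h6 : Nonex (6 + (h - 6)) B 8 := by
    have : (6 : ℤ) + (h - 6) = h := by ring
    rw [this]; exact hn
  have hn6 : Nonex 6 B 8 := nonex_of_nonex_up (h - 6) (by linarith) h6
  exact hn6 D onAlphabet_D a1_D a4_D mu_ne (by rw [copies_eq]; exact hB) (le_of_eq rank_eq.symm)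

/-- `FloorFree 6 B 8` is false for every `B ≥ 5008`: the P-cell `(0;3,3)⁴` of `D` is a floor cell. -/
theorem not_floorFree_six (B : ℕ) (hB : 5008 ≤ B) : ¬ FloorFree 6 B 8 := by
  intro hf
  have h := hf D onAlphabet_D a1_D a4_D mu_ne (by rw [copies_eq]; exact hB) (le_of_eq rank_eq.symm) floor4
    (List.mem_append.2 (Or.inr floor4_suppP)) 0
  exact absurd h (by decide)

/-- the budget-free form of the conjecture of record is false at every height `≥ 6`. -/
theorem exists_design (h : ℤ) (hh : 6 ≤ h) :
    ∃ E : Design, E.OnAlphabet h ∧ E.A1 ∧ E.A4 ∧ E.mu ≠ 0 ∧ E.copies = 5008 ∧ E.rank = 8 := by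
  refine ⟨shiftD (h - 6) D, ?_, a1_shiftD (h - 6) D a1_D, a4_shift D (h - 6) a4_D, ?_, ?_, ?_⟩
  · have e : (shiftD (h - 6) D).OnAlphabet (6 + (h - 6)) := onAlphabet_shift_up D 6 (h - 6) (by linarith) onAlphabet_D
    have : (6 : ℤ) + (h - 6) = h := by ring
    rw [this] at e
    exact e
  · rw [mu_shiftD]; exact mu_ne
  · rw [copies_shift]; exact copies_eq
  · rw [rank_shift]; exact rank_eq

end Summit.HodgeConjecture.HodgeConjecture.Cruxes.BlochSeedDiscOne.RotatedPairA4Design
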